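import Mathlib.Analysis.SpecialFunctions.Log.Deriv
import HarnessLib

/-!
# Venture YMGap, track Y3 FLOW-DATA — certified enclosures of `E = ln λ − ln λ'` from enclosures of `λ, λ'`
# (lineage C standard certificate, step S5 «energies by rational interval logarithm»)

HONEST FRAMING: venture file of the cell `pub-ymgap` (QuantumFields programme), track Y3, lineage C (engine-3; `certify.py`'s
`ilog` / `ln_rat`, bookkeeping `engine/sce/CERT-CHAIN-C.md` step S5).  One-variable real analysis; NO lattice, no number of record,
nothing about limits or a mass gap.

Every energy-type row of the one-site tables (`E₁ = ln λ₀ − ln λ₀_e`, `E₂`, `m = ln λ₀ − ln λ₁`, `m′`, `E_mag`) is obtained from the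
certified eigenvalue enclosures `λ ∈ [a, b]`, `λ' ∈ [c, d]` (`0 < a`, `0 < c`) as `E ∈ [ln(a/d), ln(b/c)]`, and each logarithm of a
positive rational `u < 2` is enclosed by the alternating/Taylor series of `ln(1 − x)`, `x = 1 − u`, with Mathlib's remainder bound
`|Σ_{i<n} x^{i+1}/(i+1) + ln(1 − x)| ≤ |x|^{n+1}/(1 − |x|)` (`Real.abs_log_sub_add_sum_range_le`).  This file types both steps:

* `log_sub_log_mem_Icc` — monotonicity: `ln λ − ln λ' ∈ [ln(a/d), ln(b/c)]`;
* `log_mem_Icc_taylor` — for `0 < u < 2` and every `n`: `ln u ∈ [−S_n(1−u) − R_n, −S_n(1−u) + R_n]`,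
  `S_n(x) = Σ_{i<n} x^{i+1}/(i+1)`, `R_n = |x|^{n+1}/(1 − |x|)` — all endpoints rational when `u` is;
* `log_sub_log_mem_Icc_taylor` — the two combined (the shape of `certify.py`'s output intervals).

References: the series is [folklore] (Mercator); Mathlib `Real.abs_log_sub_add_sum_range_le`.
-/

noncomputable section

open Finset
open scoped BigOperators

namespace Summit.Ventures.YMGap.FlowData.LogRatioEnclosure

/-- The Taylor partial sum `S_n(x) = Σ_{i<n} x^{i+1}/(i+1)` of `−ln(1 − x)`. [folklore] -/
def taylorSum (x : ℝ) (n : ℕ) : ℝ := ∑ i ∈ range n, x ^ (i + 1) / (i + 1)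

/-- The remainder bound `R_n(x) = |x|^{n+1}/(1 − |x|)`. [folklore] -/
def taylorRem (x : ℝ) (n : ℕ) : ℝ := |x| ^ (n + 1) / (1 - |x|)

/-- ★ Monotonicity step: `λ ∈ [a, b]`, `λ' ∈ [c, d]`, `0 < a`, `0 < c` ⇒ `ln λ − ln λ' ∈ [ln(a/d), ln(b/c)]`. [folklore] -/
theorem log_sub_log_mem_Icc {lam lam' a b c d : ℝ} (ha : 0 < a) (hc : 0 < c)
    (hlam : lam ∈ Set.Icc a b) (hlam' : lam' ∈ Set.Icc c d) :
    Real.log lam - Real.log lam' ∈ Set.Icc (Real.log (a / d)) (Real.log (b / c)) := by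
  obtain ⟨h1, h2⟩ := hlam
  obtain ⟨h3, h4⟩ := hlam'
  have hlam0 : 0 < lam := ha.trans_le h1
  have hlam'0 : 0 < lam' := hc.trans_le h3
  have hd : 0 < d := hlam'0.trans_le h4
  have hb : 0 < b := hlam0.trans_le h2
  rw [Real.log_div ha.ne' hd.ne', Real.log_div hb.ne' hc.ne']
  constructor
  · exact sub_le_sub (Real.log_le_log ha h1) (Real.log_le_log hlam'0 h4)
  · exact sub_le_sub (Real.log_le_log hlam0 h2) (Real.log_le_log hc h3)

/-- ★ Taylor enclosure of `ln u` for `0 < u < 2`: with `x = 1 − u` (`|x| < 1`),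
`ln u ∈ [−S_n(x) − R_n(x), −S_n(x) + R_n(x)]` for every `n`. [folklore] -/
theorem log_mem_Icc_taylor {u : ℝ} (hu0 : 0 < u) (hu2 : u < 2) (n : ℕ) :
    Real.log u ∈ Set.Icc (-taylorSum (1 - u) n - taylorRem (1 - u) n)
      (-taylorSum (1 - u) n + taylorRem (1 - u) n) := by
  have hx : |1 - u| < 1 := abs_lt.2 ⟨by linarith, by linarith⟩
  have h := Real.abs_log_sub_add_sum_range_le hx n
  rw [sub_sub_cancel] at h
  obtain ⟨hlo, hhi⟩ := abs_le.1 h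
  simp only [taylorSum, taylorRem]
  constructor <;> linarith

/-- ★ **Assembled (the shape of `certify.py`'s energy intervals).**  From `λ ∈ [a, b]`, `λ' ∈ [c, d]` with `0 < a`, `0 < c`, `a/d < 2`,
`b/c < 2`, and any orders `n₁, n₂`:
`ln λ − ln λ' ∈ [−S_{n₁}(1 − a/d) − R_{n₁}(1 − a/d), −S_{n₂}(1 − b/c) + R_{n₂}(1 − b/c)]` — rational endpoints for rational data. [folklore] -/
theorem log_sub_log_mem_Icc_taylor {lam lam' a b c d : ℝ} (ha : 0 < a) (hc : 0 < c)
    (hlam : lam ∈ Set.Icc a b) (hlam' : lam' ∈ Set.Icc c d) (had : a / d < 2) (hbc : b / c < 2) (n₁ n₂ : ℕ) :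
    Real.log lam - Real.log lam' ∈
      Set.Icc (-taylorSum (1 - a / d) n₁ - taylorRem (1 - a / d) n₁) (-taylorSum (1 - b / c) n₂ + taylorRem (1 - b / c) n₂) := by
  have hmono := log_sub_log_mem_Icc ha hc hlam hlam'
  have hd : 0 < d := (hc.trans_le hlam'.1).trans_le hlam'.2
  have hb : 0 < b := (ha.trans_le hlam.1).trans_le hlam.2
  have hlo := (log_mem_Icc_taylor (div_pos ha hd) had n₁).1
  have hhi := (log_mem_Icc_taylor (div_pos hb hc) hbc n₂).2
  exact ⟨hlo.trans hmono.1, hmono.2.trans hhi⟩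

/-- The remainder bound is non-negative for `|x| < 1`. [folklore] -/
theorem taylorRem_nonneg {x : ℝ} (hx : |x| < 1) (n : ℕ) : 0 ≤ taylorRem x n :=
  div_nonneg (pow_nonneg (abs_nonneg x) _) (by linarith)

end Summit.Ventures.YMGap.FlowData.LogRatioEnclosure

end
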